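import Literature.AlgebraicGeometry.Frobenioids.UnitTrivializationBiratSubgroup
import Literature.AlgebraicGeometry.Frobenioids.UnitTrivializationModelType
import Literature.AlgebraicGeometry.Frobenioids.BiratUnitsSubfunctor
import Literature.AlgebraicGeometry.Frobenioids.BiratUnitsConjugation
import Literature.AlgebraicGeometry.Frobenioids.ModelFrobenioidComparisonFull2
import Literature.AlgebraicGeometry.Frobenioids.FrobenioidRealification
import HarnessLib

/-!
# Frobenioids I, Prop. 5.3 / Prop. 5.5 (iv): THE comparison equivalence `C^un-tr ⥲` (model Frobenioid of
# `(Φ, Φ^birat ↪ Φ^gp)`) — the rational function monoid of `C^un-tr` is `Φ^birat`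

Mochizuki, *The geometry of Frobenioids I: the general theory*, Kyushu J. Math. **62** (2008) 293–400,
§5, Prop. 5.3 p. 103 ll. 16–19 [cite: MochizukiFrdI2008, Prop. 5.3 p.103]: "Moreover, the Frobenioid
`C^un-tr` [cf. Proposition 3.3, (iv)] … is of model type [cf. Theorem 5.2; Proposition 5.5, (iii)] and
may be obtained as the model Frobenioid associated to the divisor monoid `Φ` … and the rational function
monoid `Φ^birat`" (proof, p. 103 ll. 34–36: "Since Frobenioids of unit-trivial type are always of model
type [cf. Theorem 5.1, (iv)], the various assertions … follow immediately from the definitions and Theorem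
5.2, (ii), (iv)"); Prop. 5.5 (iv) p. 104; Prop. 4.4 (iii) p. 83 (`1 → O^×(A) → O^×(A^birat) → Φ^birat(A) → 1`).

WHAT IS PROVED (abc-iut cell, layer L1; the INPUT `e` of rows P53/L03, L05c, C54/L06, C54/L09 of
`plan/L1/SUBDAG-FrdI-Prop53-Cor54.md`, seat abc-iut-w5-d137; this file seat abc-iut-L1-d5, owner of THE
unit-trivialisation `untrFunctor hF : C^un-tr → F_Φ`).  For a Frobenioid `C → F_Φ` (`hF`):

* `biratSubgroup_untr_eq` — `Φ^birat_{C^un-tr}(X) = Φ^birat_C(X)` for every `X ∈ Ob(D)`: the inclusion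
  `⊆` reads a birational germ of `C^un-tr` on representatives in `C^istr ⊆ C` (Prop. 3.3 (iv): `Base`,
  `Div`, pre-steps of classes are those of representatives; seat abc-iut-L1-d5's dictionary), the
  inclusion `⊇` is seat abc-iut-w5-d250's `biratSubgroup_le_untr` (germs moved to isotropic hulls);
* `divHom_untr_injective`, `range_divHom_untr` — for `A ∈ Ob(C^un-tr)` the divisor homomorphism
  `O^×(A^birat) → Φ^gp(A_D)` of Prop. 4.4 (iii) (seat abc-iut-L6-t8's `BiratUnits.divHom`) is INJECTIVE
  (`C^un-tr` is of unit-trivial type, so the kernel `O^×(A)` of Prop. 4.4 (iii) vanishes) with image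
  `Φ^birat_C(A_D)` (`C^un-tr` is of isotropic type: `BiratUnits.range_divHom_eq_biratSubgroup` + the
  equality above);
* `nonempty_untrRationalFunctionMonoidStr hF` — hence "`Φ^birat ↪ Φ^gp` IS the rational function
  monoid of `C^un-tr`": the structure `RationalFunctionMonoidStr (untrFunctor hF) _ (Φ^birat) (Φ^birat ↪ Φ^gp)` of
  Thm. 5.2 (iv) (isomorphisms `Φ^birat(A_D) ⥲ O^×(A^birat)` inverse to `Div`, compatible with `Div_B = ι`,
  natural along linear morphisms by uniqueness of transports, `BiratUnits.divHom_eq_of_intertwines`);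
* `exists_untr_comparison` — by Theorem 5.2 (iv) (seat abc-iut-L6-t8's `thm52iv_holds`, 2024 form:
  isotropic + model type, here `isOfIsotropicType_untr` / `isOfModelType_untr'`) there is an EQUIVALENCE
  `E : C^un-tr ⥲ untrModel F` (= the model Frobenioid of `(Φ, Φ^birat, Φ^birat ↪ Φ^gp)`, seat
  abc-iut-L1-t5's `PreFrobenioid.untrModel`) that is `1`-compatible with `C^un-tr → F_Φ` and
  `untrModel F → F_Φ`;
* `prop53_untr_holds` — seat abc-iut-L1-t5's typed schema `PreFrobenioid.Prop53_untr` CLOSED AT THE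
  CONSTRUCTIONS `FU := untrFunctor hF`, `BU :=` THE birationalization datum of `C^un-tr`.

Honest framing: kernel check of a 2008 published statement ([FrdI]); nothing here bears on [IUTchIII]
Cor. 3.12; typed ≠ proved elsewhere. Proof-only (no `def`): the rational-function-monoid structure is
delivered as `Nonempty`, which is all that Thm. 5.2 (iv) and the consumers of `e` need.
-/

noncomputable section

namespace Literature.AlgebraicGeometry.Frobenioids

open CategoryTheory Opposite

universe w v v' u u'

namespace PreFrobenioid

variable {D : Type u} [Category.{v} D] {Φ : Dᵒᵖ ⥤ CommMonCat.{w}}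
  {C : Type u'} [Category.{v'} C] {F : C ⥤ ElemFrobenioid Φ}

open PreFrobenioidData (ofFunctor)

/-! ### `Φ^birat_{C^un-tr} = Φ^birat_C` -/

/-- A birational germ of `C^un-tr` at `[A]` is a birational germ of `C` at `A`: write the two pre-steps
of `C^un-tr` as classes of arrows `a₁, a₂ : Y → A` of `C^istr` (Prop. 3.3 (iii): `C^istr → C^un-tr` is
full); these are base-equivalent pre-steps of `C`, `a₁` co-angular (its source is isotropic), with the
same `(Base)⁻¹^* Div` (Prop. 3.3 (iv)). [cite: MochizukiFrdI2008, Prop. 3.3 (iv) p.60] -/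
theorem biratGerms_untr_subset (hF : IsFrobenioid F) (U : (ofFunctor Φ F).Untr) :
    biratGerms (untrFunctor hF) U ⊆ biratGerms F U.as.obj := by
  rintro d ⟨Yu, δ₁, δ₂, h₁, h₂, hb, rfl⟩
  obtain ⟨a₁, rfl⟩ := (ofFunctor Φ F).toUntr.map_surjective (X := Yu.as) (Y := U.as) δ₁
  obtain ⟨a₂, rfl⟩ := (ofFunctor Φ F).toUntr.map_surjective (X := Yu.as) (Y := U.as) δ₂
  exact ⟨Yu.as.obj, a₁.hom, a₂.hom, isCoAngularPreStep_of_toUntr hF a₁ h₁,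
    (isPreStep_toUntr_iff a₂).mp h₂, hb, rfl⟩

/-- Every generator `Φ(f)(d)` of `Φ^birat_{C^un-tr}(X)` is a generator of `Φ^birat_C(X)`.
[cite: MochizukiFrdI2008, Prop. 5.5 (iv) p.104] -/
theorem biratGenerators_untr_subset (hF : IsFrobenioid F) (X : D) :
    biratGenerators (untrFunctor hF) X ⊆ biratGenerators F X := by
  rintro c ⟨U, f, d, hd, rfl⟩
  exact ⟨U.as.obj, f, d, biratGerms_untr_subset hF U hd, rfl⟩

/-- `Φ^birat_{C^un-tr}(X) ⊆ Φ^birat_C(X)`. [cite: MochizukiFrdI2008, Prop. 5.5 (iv) p.104] -/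
theorem biratSubgroup_untr_le (hF : IsFrobenioid F) (X : D) :
    biratSubgroup (untrFunctor hF) X ≤ biratSubgroup F X := by
  change Subgroup.closure (biratGenerators (untrFunctor hF) X) ≤ Subgroup.closure (biratGenerators F X)
  exact Subgroup.closure_mono (biratGenerators_untr_subset hF X)

/-- **`Φ^birat_{C^un-tr} = Φ^birat_C`** (Prop. 5.5 (iv): "`C^un-tr` … the model Frobenioid associated to
the data `Φ, Φ^birat, Φ^birat ↪ Φ^gp`" — the SAME rational function monoid), for THE concrete subfunctor
`biratSubfunctor` of both Frobenioids. [cite: MochizukiFrdI2008, Prop. 5.5 (iv) p.104] -/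
theorem biratSubgroup_untr_eq (hF : IsFrobenioid F) (X : D) :
    biratSubgroup (untrFunctor hF) X = biratSubgroup F X :=
  le_antisymm (biratSubgroup_untr_le hF X) (biratSubgroup_le_untr hF X)

/-! ### Prop. 4.4 (iii) for `C^un-tr`: `O^×(A^birat) ⥲ Φ^birat(A_D)` -/

/-- For `A ∈ Ob(C^un-tr)` the divisor homomorphism `O^×(A^birat) → Φ^gp(A_D)` is injective: its kernel is
the image of `O^×(A)` (Prop. 4.4 (iii)), which is trivial since `C^un-tr` is of unit-trivial type
(Prop. 3.3 (iv)). [cite: MochizukiFrdI2008, Prop. 4.4 (iii) p.83] -/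
theorem divHom_untr_injective (hF : IsFrobenioid F) (A : (ofFunctor Φ F).Untr) :
    Function.Injective (BiratUnits.divHom (isFrobenioid_untr hF) A) := by
  refine (injective_iff_map_eq_one _).mpr fun x hx => ?_
  obtain ⟨u, rfl⟩ := (BiratUnits.divHom_eq_one_iff x).mp hx
  have hu : u = 1 := Subtype.ext (isOfUnitTrivialType_untr hF A u.1 u.2)
  rw [hu, map_one]

/-- … and its image is `Φ^birat_C(A_D)` (`C^un-tr` is of isotropic type, so Prop. 4.4 (iii)'s
surjectivity `O^×(A^birat) ↠ Φ^birat_{C^un-tr}(A_D)` applies, and `Φ^birat_{C^un-tr} = Φ^birat_C`).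
[cite: MochizukiFrdI2008, Prop. 4.4 (iii) p.83] -/
theorem range_divHom_untr (hF : IsFrobenioid F) (A : (ofFunctor Φ F).Untr) :
    (BiratUnits.divHom (isFrobenioid_untr hF) A).range = biratSubgroup F (baseObj (untrFunctor hF) A) := by
  rw [BiratUnits.range_divHom_eq_biratSubgroup (isFrobenioid_untr hF) A (isOfIsotropicType_untr hF)]
  exact biratSubgroup_untr_eq hF _

/-! ### `Φ^birat ↪ Φ^gp` is the rational function monoid of `C^un-tr` -/

/-- **The rational function monoid of `C^un-tr` is `(Φ^birat, Φ^birat ↪ Φ^gp)`** (Prop. 5.3 / Prop. 5.5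
(iv)): `C^un-tr → F_Φ` carries a `RationalFunctionMonoidStr` (Thm. 5.2 (iv)'s hypothesis "`B` is the
rational function monoid, `Div_B` the natural homomorphism") at `B := Φ^birat_C`, `Div_B :=` the inclusion
— the isomorphisms `Φ^birat(A_D) ⥲ O^×(A^birat)` inverse to `Div` (`divHom_untr_injective`,
`range_divHom_untr`), compatible with `Div_B` by construction, and natural along linear morphisms (the
transport `u` of `v` along a linear `ψ`, Prop. 2.2 (ii), has `Div u = Base(ψ)^* Div v`,
`BiratUnits.divHom_eq_of_intertwines`, and `Div` is injective on `O^×(A^birat)`).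
[cite: MochizukiFrdI2008, Prop. 5.3 p.103] -/
theorem nonempty_untrRationalFunctionMonoidStr (hF : IsFrobenioid F) :
    Nonempty (RationalFunctionMonoidStr (untrFunctor hF) (isFrobenioid_untr hF)
      (biratSubfunctor F).toMonoid (biratSubfunctor F).incl) := by
  -- the divisor homomorphisms with codomain restricted to `Φ^birat_C(A_D)` are bijective
  let g : ∀ A : (ofFunctor Φ F).Untr, BiratUnits (untrFunctor hF) (isFrobenioid_untr hF) A →*
      (biratSubfunctor F).toMonoid.obj (op (baseObj (untrFunctor hF) A)) := fun A =>
    (BiratUnits.divHom (isFrobenioid_untr hF) A).codRestrict (biratSubgroup F (baseObj (untrFunctor hF) A))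
      fun u => by
        rw [← range_divHom_untr hF A]
        exact ⟨u, rfl⟩
  have hg : ∀ A, Function.Bijective (g A) := fun A => by
    refine ⟨fun u v h => divHom_untr_injective hF A (congrArg Subtype.val h), fun c => ?_⟩
    have hc : c.1 ∈ (BiratUnits.divHom (isFrobenioid_untr hF) A).range := by
      rw [range_divHom_untr hF A]
      exact c.2
    obtain ⟨u, hu⟩ := hc
    exact ⟨u, Subtype.ext hu⟩
  -- their inverses `Φ^birat_C(A_D) ⥲ O^×(A^birat)`
  let ι : ∀ A : (ofFunctor Φ F).Untr,
      (biratSubfunctor F).toMonoid.obj (op (baseObj (untrFunctor hF) A)) ≃*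
        BiratUnits (untrFunctor hF) (isFrobenioid_untr hF) A := fun A =>
    (MulEquiv.ofBijective (g A) (hg A)).symm
  have hι : ∀ A b, BiratUnits.divHom (isFrobenioid_untr hF) A (ι A b) = b.1 := fun A b =>
    congrArg Subtype.val ((MulEquiv.ofBijective (g A) (hg A)).apply_symm_apply b)
  refine ⟨{ iso := ι, div_iso := hι, natural := ?_ }⟩
  intro A A' ψ hψ b'
  have hi := BiratUnits.intertwines_transportHom (hF := isFrobenioid_untr hF)
    (hsq := hasBiratSquares_untr hF) (isOfIsotropicType_untr hF) ψ hψ (ι A' b')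
  have hd := BiratUnits.divHom_eq_of_intertwines (hasBiratSquares_untr hF) hψ hi
  rw [hι] at hd
  have hp : pullGp Φ (Base (untrFunctor hF) ψ) b'.1 =
      (((biratSubfunctor F).toMonoid.map (Base (untrFunctor hF) ψ).op).hom b').1 := rfl
  have he : BiratUnits.transportHom (isFrobenioid_untr hF) (hasBiratSquares_untr hF)
      (isOfIsotropicType_untr hF) ψ hψ (ι A' b') =
      ι A (((biratSubfunctor F).toMonoid.map (Base (untrFunctor hF) ψ).op).hom b') :=
    divHom_untr_injective hF A ((hd.trans hp).trans (hι A _).symm)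
  rw [← he]
  exact hi

/-! ### Theorem 5.2 (iv) at `C^un-tr`: the comparison equivalence -/

variable (F) in
/-- **`C^un-tr ⥲` the model Frobenioid of `(Φ, Φ^birat ↪ Φ^gp)`** (Prop. 5.3 "may be obtained as the
model Frobenioid associated to `Φ` and `Φ^birat`"; Prop. 5.5 (iv)): there is an equivalence of categories
`E : C^un-tr ⥲ untrModel F`, `1`-compatible with the functors `C^un-tr → F_Φ` (`untrFunctor hF`) and
`untrModel F → F_Φ` — Theorem 5.2 (iv) (2024 form: isotropic + model type, both automatic for `C^un-tr`
by Thm. 5.1 (iv)) applied to the rational-function-monoid structure of `nonempty_untrRationalFunctionMonoidStr`.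
[cite: MochizukiFrdI2008, Prop. 5.3 p.103] -/
theorem exists_untr_comparison (hF : IsFrobenioid F) :
    ∃ E : (ofFunctor Φ F).Untr ⥤ untrModel F, E.IsEquivalence ∧
      OneCommutes E (ModelFrobenioid.toElem Φ (biratSubfunctor F).toMonoid (biratSubfunctor F).incl)
        (untrFunctor hF) (𝟭 (ElemFrobenioid Φ)) :=
by
  obtain ⟨R⟩ := nonempty_untrRationalFunctionMonoidStr hF
  exact thm52iv_holds (isFrobenioid_untr hF) (hasBiratSquares_untr hF)
    ⟨isOfModelType_untr' hF, isOfIsotropicType_untr hF⟩ _ _ R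

variable (F) in
/-- **Prop. 5.3, "Moreover", `C^un-tr` half, AT THE CONSTRUCTIONS** (seat abc-iut-L1-t5's schema
`PreFrobenioid.Prop53_untr` with `FU := untrFunctor hF` and `BU :=` THE birationalization datum of the
Frobenioid `C^un-tr`): `C^un-tr` is of model type (pre-model, Def. 2.7 (iii), and birationally
Frobenius-normalized, Def. 4.5 (i) — Thm. 5.1 (iv) / Prop. 5.5 (iii)) AND there is an equivalence
`e : C^un-tr ≌ untrModel F` with `e ⋙ (untrModel F → F_Φ) ≅ (C^un-tr → F_Φ)`.
[cite: MochizukiFrdI2008, Prop. 5.3 p.103] -/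
theorem prop53_untr_holds (hF : IsFrobenioid F) :
    Literature.AlgebraicGeometry.Frobenioids.PreFrobenioid.Prop53_untr F (untrFunctor hF)
      (biratData (isFrobenioid_untr hF) (hasBiratSquares_untr hF)) := by
  intro _ _
  refine ⟨⟨(isOfModelType_untr' hF).1, isOfBiratFrobeniusNormalizedType_biratData_untr hF _⟩, ?_⟩
  obtain ⟨E, hE, ⟨e⟩⟩ := exists_untr_comparison F hF
  letI := hE
  exact ⟨E.asEquivalence, ⟨e ≪≫ (untrFunctor hF).rightUnitor⟩⟩

end PreFrobenioid

end Literature.AlgebraicGeometry.Frobenioids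

end
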